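import Literature.NumberTheory.ComplexMultiplication.SerreGroupLimitLevelCharacters
import HarnessLib

/-!
# The quotient `S ↠ S^K` of the Serre group ON POINTS in the tree's two carriers: g13-#4's `serreLevelPoints R K = Hom_Γ(Λ^K, (ℚ^{cm} ⊗ R)ˣ)`
# IS skel-3/g11's `serrePoints ℚ ℚ^{cm} K ι R = Hom_Γ(X^*(S^K), (ℚ^{cm} ⊗ R)ˣ)`, compatibly with the projections `S(R) → S^K(R)` and with the
# norm maps `S^{K′} → S^K` (J. S. Milne, *Complex Multiplication*, Ch. I §4 p. 42 «(S, μ_can) = lim← (S^K, μ^K)», Prop. 4.20; LNM 900 III §1)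

Family `hodge`, lane `lit-hodgefound` (Layer A3; seat `lit-hodgefound-p27`, generation 20, row g20-#3 FILE 3); topic
`Literature/NumberTheory/ComplexMultiplication`, namespace `Literature.NumberTheory.ComplexMultiplication.CMNumbers`.  Definitions WITH BODIES
(`levelRestrict`, `levelExtend`, `levelCharEquiv`, `serreLevelPointsToSerrePoints`, `serrePointsToSerreLevelPoints`, `serreLevelPointsEquiv`) validated
in-file; no named fact (D-0026, net debt 0).  Direct sequel of FILE 1 `SerreGroupLimitLevelCharacters` (✔ p372435: on CHARACTERS, `Λ^K = lambdaLevel K`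
is `infinityTypes Γ Hom(K, ℚ^{cm}) ι` transported along `σ ↦ σ|_K`, `levelChar` / `extendLevel`); this file is the same identification ON POINTS, so that
g13-#4's inverse system (`serreLimitPoints R → serreLevelPoints R K`, `toLevel`, `transition`) and the finite-level point functors of skel-3 / g11 / g16
(`serrePoints`, `normSerre`, `alphaPointsOfPrime`) can be composed.

THE PRINT.  [MilneCM2006] Ch. I §4 p. 42: «define `(S, μ_can) = lim← (S^K, μ^K)` … The character group of `S` is `I = lim→ I(K)`»; Prop. 4.20: for
`K ⊂ L` the norm map `S^L → S^K` is the map of tori whose `X^*` is `f ↦ f_L : I(K) → I(L)`.  [MilneShih1982Taniyama] III §1 p. 231: «`S^L` is the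
largest quotient of `S` that splits over `L`»; (1.3) transport of structure along `σ ↦ σ|L`.  [Milne2017] Ch. 12 Thm. 12.9 (a) / 12.23: `X ↦ D(X)`,
`D(X)(R) = Hom(X, (L ⊗ R)ˣ)^Γ`, is a contravariant equivalence (an isomorphism of character modules gives an isomorphism of point groups).

WHAT IS PROVED.
* §1 DEF `levelRestrict K : Λ^K →ₗ[ℤ] X^*(S^K)` (`F ↦ F|_K`) and DEF `levelExtend K : X^*(S^K) →ₗ[ℤ] Λ^K` (`f ↦ f^{ℚ^{cm}}`), mutually inverse
  (`levelRestrict_levelExtend`, `levelExtend_levelRestrict`), packaged as DEF **`levelCharEquiv K : Λ^K ≃ₗ[ℤ] X^*(S^K)`**; both `Γ`-EQUIVARIANT for g13-#4's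
  `lambdaLevelRep K` and skel-3's `infinityTypesRep` (`levelRestrict_rep`, `levelExtend_rep`); `inclusion_levelExtend` (followed by `Λ^K ⊆ I` it is FILE 1's
  `extendLevel`), `inclusion_mono_levelExtend` (for `K ⊆ K′`: `Λ^K ⊆ Λ^{K′}` is `X^*(Nm) = inflateI (restrictEmb (K ⊂ K′))` — FILE 1 `levelChar_mono`
  read on `levelExtend`).
* §2 DEF **`serreLevelPointsEquiv R K : serreLevelPoints R K ≃* serrePoints ℚ ℚ^{cm} K ι R`** for every commutative `ℚ`-algebra `R` (Q768 FILE 1's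
  `torusPoints.comap` along the two equivariant maps), with values `serreLevelPointsEquiv_apply_ofAdd` (`s ↦ (f ↦ s(f^{ℚ^{cm}}))`), naturality in `R`
  (`map_serreLevelPointsEquiv`), **`serreLevelPointsEquiv_toLevel_apply_ofAdd`** (the projection `S(R) → S^K(R)` followed by the identification evaluates a
  point `s ∈ S(R)` at FILE 1's `extendLevel K f`), and **`serreLevelPointsEquiv_transition`**: for `K ⊆ K′` g13-#4's transition map `S^{K′}(R) → S^K(R)`
  IS g11's norm map `normSerre … (levelInclusion (K ⊆ K′)) R` under the identifications (Prop. 4.20 on points).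

## Shape of the entries

* Vocabulary: FILE 1 `resLevel`, `levelChar`, `levelInclusion`, `extendLevel`; g13-#4 `lambdaLevel`, `lambdaLevelRep`, `serreLimitPoints`,
  `serreLevelPoints`, `toLevel`, `transition`; skel-3 `infinityTypes`, `inflate`, `SerreGroupTorus.infinityTypesRep` / `inflateI` / `serrePoints`; g11-#4
  `SerreGroupTorus.normSerre`; Q768 `torusPoints.comap` / `torusPoints.map`.
* Levels are `K : IntermediateField ℚ cmNumbers` with `[FiniteDimensional ℚ K]`; `R : Type u` as in g13-#4.

## References

* [MilneCM2006] J. S. Milne, *Complex Multiplication* (course notes, 2006), Ch. I §4 p. 42 («(S, μ_can) = lim← (S^K, μ^K)», «The character group of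
  `S` is `I`»), Prop. 4.20 (the norm maps).
* [MilneShih1982Taniyama] J. S. Milne, K.-y. Shih, *Langlands's construction of the Taniyama group*, LNM 900 (1982), Ch. III §1 (1.3), p. 231.
* [Milne2017] J. S. Milne, *Algebraic Groups*, CUP 2017, Ch. 12 Thm. 12.9 (a), Thm. 12.23 (groups of multiplicative type vs. character modules).

Provenance: lane `lit-hodgefound`, seat `lit-hodgefound-p27` gen 20 (agent `literature-prover-lit-hodgefound-p27-g20-0`), row g20-#3 FILE 3.
-/

set_option autoImplicit false

noncomputable section

open scoped TensorProduct IntermediateField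

namespace Literature.NumberTheory.ComplexMultiplication

namespace CMNumbers

open Literature.NumberTheory.NumberFields (cmNumbers cmNumbersConj)
open SerreGroupTorus (inflateI coe_inflateI_apply inflateI_apply_apply infinityTypesRep coe_infinityTypesRep_apply serrePoints normSerre
  normSerre_apply_ofAdd)
open Literature.RingTheory.GaloisAlgebras.CharacterModuleTorus (torusPoints torusPoints.comap torusPoints.comap_apply_ofAdd torusPoints.map
  torusPoints.map_comap)

universe u

/-! ### §1 `Λ^K ≃ X^*(S^K)` as `Γ`-modules -/

section Characters

variable (K : IntermediateField ℚ cmNumbers)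

/-- **`F ↦ F|_K : Λ^K → X^*(S^K)`** as an additive map (FILE 1's `levelChar` on the bundled level). [cite: MilneShih1982Taniyama, III §1 (1.3) (p. 231)] -/
def levelRestrictAddHom : lambdaLevel K →+ infinityTypes (cmNumbers ≃ₐ[ℚ] cmNumbers) (K →ₐ[ℚ] cmNumbers) cmNumbersConj where
  toFun F := levelChar K (F : (cmNumbers ≃ₐ[ℚ] cmNumbers) → ℤ) F.2
  map_zero' := levelChar_zero
  map_add' F G := levelChar_add _ _ F.2 G.2

/-- **`F ↦ F|_K : Λ^K →ₗ[ℤ] X^*(S^K)`.** [cite: MilneShih1982Taniyama, III §1 (1.3) (p. 231)] -/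
def levelRestrict : lambdaLevel K →ₗ[ℤ] infinityTypes (cmNumbers ≃ₐ[ℚ] cmNumbers) (K →ₐ[ℚ] cmNumbers) cmNumbersConj :=
  (levelRestrictAddHom K).toIntLinearMap

/-- Unfolding `levelRestrict`. [cite: MilneShih1982Taniyama, III §1 (1.3) (p. 231)] -/
theorem levelRestrict_apply (F : lambdaLevel K) : levelRestrict K F = levelChar K (F : (cmNumbers ≃ₐ[ℚ] cmNumbers) → ℤ) F.2 := rfl

/-- **`f ↦ f^{ℚ^{cm}} : X^*(S^K) →ₗ[ℤ] Λ^K`** (`[K : ℚ] < ∞`; FILE 1's `inflate (resLevel K)` with its image membership). [cite: MilneCM2006, Ch. I §4 p. 40 («f ↦ f_L»)] -/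
def levelExtend [FiniteDimensional ℚ K] : infinityTypes (cmNumbers ≃ₐ[ℚ] cmNumbers) (K →ₐ[ℚ] cmNumbers) cmNumbersConj →ₗ[ℤ] lambdaLevel K :=
  LinearMap.codRestrict (lambdaLevel K)
    ((inflate (resLevel K)).comp (infinityTypes (cmNumbers ≃ₐ[ℚ] cmNumbers) (K →ₐ[ℚ] cmNumbers) cmNumbersConj).subtype)
    fun g => inflate_resLevel_mem_lambdaLevel g.2

/-- Underlying function of `levelExtend K g`. [cite: MilneCM2006, Ch. I §4 p. 40] -/
@[simp] theorem coe_levelExtend [FiniteDimensional ℚ K] (g : infinityTypes (cmNumbers ≃ₐ[ℚ] cmNumbers) (K →ₐ[ℚ] cmNumbers) cmNumbersConj) :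
    ((levelExtend K g : lambdaLevel K) : (cmNumbers ≃ₐ[ℚ] cmNumbers) → ℤ) = inflate (resLevel K) g.1 := rfl

/-- `Λ^K ⊆ I` after `levelExtend` is FILE 1's `extendLevel`. [cite: MilneCM2006, Ch. I §4 p. 42 («I = lim→ I(K)»)] -/
theorem inclusion_levelExtend [FiniteDimensional ℚ K] (g : infinityTypes (cmNumbers ≃ₐ[ℚ] cmNumbers) (K →ₐ[ℚ] cmNumbers) cmNumbersConj) :
    Submodule.inclusion (lambdaLevel_le K) (levelExtend K g) = extendLevel K g := rfl

/-- `(f^{ℚ^{cm}})|_K = f`. [cite: MilneShih1982Taniyama, III §1 (1.3) (p. 231)] -/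
@[simp] theorem levelRestrict_levelExtend [FiniteDimensional ℚ K]
    (g : infinityTypes (cmNumbers ≃ₐ[ℚ] cmNumbers) (K →ₐ[ℚ] cmNumbers) cmNumbersConj) : levelRestrict K (levelExtend K g) = g :=
  levelChar_inflate_resLevel g

/-- `(F|_K)^{ℚ^{cm}} = F`. [cite: MilneShih1982Taniyama, III §1 (1.3) (p. 231)] -/
@[simp] theorem levelExtend_levelRestrict [FiniteDimensional ℚ K] (F : lambdaLevel K) : levelExtend K (levelRestrict K F) = F :=
  Subtype.ext (inflate_resLevel_levelChar K _ F.2)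

/-- **`Λ^K ≃ X^*(S^K)`**: g13-#4's level and skel-3's character group of `S^K` are isomorphic `ℤ`-modules via `F ↦ F|_K`, `f ↦ f^{ℚ^{cm}}`.
[cite: MilneShih1982Taniyama, III §1 (1.3) (p. 231)] [cite: MilneCM2006, Ch. I §4 p. 42] -/
def levelCharEquiv [FiniteDimensional ℚ K] : lambdaLevel K ≃ₗ[ℤ] infinityTypes (cmNumbers ≃ₐ[ℚ] cmNumbers) (K →ₐ[ℚ] cmNumbers) cmNumbersConj :=
  LinearEquiv.ofLinear (levelRestrict K) (levelExtend K) (LinearMap.ext (levelRestrict_levelExtend K)) (LinearMap.ext (levelExtend_levelRestrict K))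

/-- `levelCharEquiv` is `levelRestrict`. [cite: MilneShih1982Taniyama, III §1 (1.3) (p. 231)] -/
@[simp] theorem levelCharEquiv_apply [FiniteDimensional ℚ K] (F : lambdaLevel K) : levelCharEquiv K F = levelRestrict K F := rfl

/-- `levelCharEquiv.symm` is `levelExtend`. [cite: MilneShih1982Taniyama, III §1 (1.3) (p. 231)] -/
@[simp] theorem levelCharEquiv_symm_apply [FiniteDimensional ℚ K] (g : infinityTypes (cmNumbers ≃ₐ[ℚ] cmNumbers) (K →ₐ[ℚ] cmNumbers) cmNumbersConj) :
    (levelCharEquiv K).symm g = levelExtend K g := rfl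

/-- **`F ↦ F|_K` is `Γ`-equivariant** (FILE 1 `levelChar_characterRep`). [cite: MilneShih1982Taniyama, III §1 (1.3) (p. 231)] -/
theorem levelRestrict_rep (σ : cmNumbers ≃ₐ[ℚ] cmNumbers) (F : lambdaLevel K) :
    levelRestrict K (lambdaLevelRep K σ F) =
      infinityTypesRep (cmNumbers ≃ₐ[ℚ] cmNumbers) (K →ₐ[ℚ] cmNumbers) cmNumbersConj σ (levelRestrict K F) :=
  levelChar_characterRep σ _ F.2

/-- **`f ↦ f^{ℚ^{cm}}` is `Γ`-equivariant.** [cite: MilneShih1982Taniyama, III §1 (1.3) (p. 231)] -/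
theorem levelExtend_rep [FiniteDimensional ℚ K] (σ : cmNumbers ≃ₐ[ℚ] cmNumbers)
    (g : infinityTypes (cmNumbers ≃ₐ[ℚ] cmNumbers) (K →ₐ[ℚ] cmNumbers) cmNumbersConj) :
    levelExtend K (infinityTypesRep (cmNumbers ≃ₐ[ℚ] cmNumbers) (K →ₐ[ℚ] cmNumbers) cmNumbersConj σ g) = lambdaLevelRep K σ (levelExtend K g) :=
  Subtype.ext (by rw [coe_levelExtend, coe_lambdaLevelRep_apply, coe_levelExtend, coe_infinityTypesRep_apply, inflate_characterRep])

variable {K} in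
/-- **`Λ^K ⊆ Λ^{K′}` is `X^*(Nm_{K′/K})`**: for `K ⊆ K′`, `(f^{ℚ^{cm}}` seen in `Λ^{K′}) = (inflateI (restrictEmb (K ⊂ K′)) f)^{ℚ^{cm}}`.
[cite: MilneCM2006, Ch. I §4 Prop. 4.20 («f ↦ f_L : I(K) → I(L) gives rise to the map Nm_{L/K}»)] -/
theorem inclusion_mono_levelExtend {K' : IntermediateField ℚ cmNumbers} [FiniteDimensional ℚ K] [FiniteDimensional ℚ K'] (h : K ≤ K')
    (g : infinityTypes (cmNumbers ≃ₐ[ℚ] cmNumbers) (K →ₐ[ℚ] cmNumbers) cmNumbersConj) :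
    Submodule.inclusion (lambdaLevel_mono h) (levelExtend K g) =
      levelExtend K' (inflateI cmNumbersConj (restrictEmb (Ω := cmNumbers) (levelInclusion h)) g) :=
  Subtype.ext (funext fun σ => by
    change g.1 (resLevel K σ) = (inflateI cmNumbersConj (restrictEmb (Ω := cmNumbers) (levelInclusion h)) g).1 (resLevel K' σ)
    rw [coe_inflateI_apply, inflate_apply, restrictEmb_levelInclusion_resLevel h])

end Characters

/-! ### §2 `S^K(R)` in the two carriers, the projections `S(R) → S^K(R)` and the norm maps -/

section Points

variable (R : Type u) [CommRing R] [Algebra ℚ R] (K : IntermediateField ℚ cmNumbers) [FiniteDimensional ℚ K]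

/-- `Hom_Γ(Λ^K, (ℚ^{cm} ⊗ R)ˣ) → Hom_Γ(X^*(S^K), (ℚ^{cm} ⊗ R)ˣ)`, `s ↦ s ∘ levelExtend`. [cite: Milne2017, Ch. 12 Thm. 12.9 (a)] -/
def serreLevelPointsToSerrePoints : serreLevelPoints R K →* serrePoints ℚ cmNumbers K cmNumbersConj R :=
  torusPoints.comap ℚ cmNumbers R (infinityTypesRep (cmNumbers ≃ₐ[ℚ] cmNumbers) (K →ₐ[ℚ] cmNumbers) cmNumbersConj) (lambdaLevelRep K)
    (levelExtend K) (levelExtend_rep K)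

/-- `Hom_Γ(X^*(S^K), (ℚ^{cm} ⊗ R)ˣ) → Hom_Γ(Λ^K, (ℚ^{cm} ⊗ R)ˣ)`, `f ↦ f ∘ levelRestrict`. [cite: Milne2017, Ch. 12 Thm. 12.9 (a)] -/
def serrePointsToSerreLevelPoints : serrePoints ℚ cmNumbers K cmNumbersConj R →* serreLevelPoints R K :=
  torusPoints.comap ℚ cmNumbers R (lambdaLevelRep K) (infinityTypesRep (cmNumbers ≃ₐ[ℚ] cmNumbers) (K →ₐ[ℚ] cmNumbers) cmNumbersConj)
    (levelRestrict K) (levelRestrict_rep K)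

variable {R K} in
/-- Values of `s ↦ s ∘ levelExtend`. [cite: Milne2017, Ch. 12 Thm. 12.9 (a)] -/
theorem serreLevelPointsToSerrePoints_apply_ofAdd (s : serreLevelPoints R K)
    (g : infinityTypes (cmNumbers ≃ₐ[ℚ] cmNumbers) (K →ₐ[ℚ] cmNumbers) cmNumbersConj) :
    (serreLevelPointsToSerrePoints R K s).1 (Multiplicative.ofAdd g) =
      (s : Multiplicative (lambdaLevel K) →* (cmNumbers ⊗[ℚ] R)ˣ) (Multiplicative.ofAdd (levelExtend K g)) := rfl

variable {R K} in
omit [FiniteDimensional ℚ K] in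
/-- Values of `f ↦ f ∘ levelRestrict`. [cite: Milne2017, Ch. 12 Thm. 12.9 (a)] -/
theorem serrePointsToSerreLevelPoints_apply_ofAdd (f : serrePoints ℚ cmNumbers K cmNumbersConj R) (F : lambdaLevel K) :
    (serrePointsToSerreLevelPoints R K f : Multiplicative (lambdaLevel K) →* (cmNumbers ⊗[ℚ] R)ˣ) (Multiplicative.ofAdd F) =
      f.1
        (Multiplicative.ofAdd (levelRestrict K F)) := rfl

variable {R K} in
/-- `(s ∘ levelExtend) ∘ levelRestrict = s`, pointwise. [cite: Milne2017, Ch. 12 Thm. 12.9 (a)] -/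
theorem serrePointsToSerreLevelPoints_serreLevelPointsToSerrePoints_apply (s : serreLevelPoints R K) (F : lambdaLevel K) :
    (serrePointsToSerreLevelPoints R K (serreLevelPointsToSerrePoints R K s) : Multiplicative (lambdaLevel K) →* (cmNumbers ⊗[ℚ] R)ˣ)
        (Multiplicative.ofAdd F) =
      (s : Multiplicative (lambdaLevel K) →* (cmNumbers ⊗[ℚ] R)ˣ) (Multiplicative.ofAdd F) := by
  rw [serrePointsToSerreLevelPoints_apply_ofAdd, serreLevelPointsToSerrePoints_apply_ofAdd, levelExtend_levelRestrict]

variable {R K} in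
/-- `(s ∘ levelExtend) ∘ levelRestrict = s`. [cite: Milne2017, Ch. 12 Thm. 12.9 (a)] -/
theorem serrePointsToSerreLevelPoints_serreLevelPointsToSerrePoints (s : serreLevelPoints R K) :
    serrePointsToSerreLevelPoints R K (serreLevelPointsToSerrePoints R K s) = s := by
  refine Subtype.ext (MonoidHom.ext fun x => ?_)
  exact serrePointsToSerreLevelPoints_serreLevelPointsToSerrePoints_apply s (Multiplicative.toAdd x)

variable {R K} in
/-- `(f ∘ levelRestrict) ∘ levelExtend = f`, pointwise. [cite: Milne2017, Ch. 12 Thm. 12.9 (a)] -/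
theorem serreLevelPointsToSerrePoints_serrePointsToSerreLevelPoints_apply (f : serrePoints ℚ cmNumbers K cmNumbersConj R)
    (g : infinityTypes (cmNumbers ≃ₐ[ℚ] cmNumbers) (K →ₐ[ℚ] cmNumbers) cmNumbersConj) :
    (serreLevelPointsToSerrePoints R K (serrePointsToSerreLevelPoints R K f)).1 (Multiplicative.ofAdd g) =
      f.1 (Multiplicative.ofAdd g) := by
  simp only [serreLevelPointsToSerrePoints_apply_ofAdd, serrePointsToSerreLevelPoints_apply_ofAdd, levelRestrict_levelExtend]

variable {R K} in
/-- `(f ∘ levelRestrict) ∘ levelExtend = f`. [cite: Milne2017, Ch. 12 Thm. 12.9 (a)] -/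
theorem serreLevelPointsToSerrePoints_serrePointsToSerreLevelPoints (f : serrePoints ℚ cmNumbers K cmNumbersConj R) :
    serreLevelPointsToSerrePoints R K (serrePointsToSerreLevelPoints R K f) = f := by
  refine Subtype.ext (MonoidHom.ext fun x => ?_)
  exact serreLevelPointsToSerrePoints_serrePointsToSerreLevelPoints_apply f (Multiplicative.toAdd x)

/-- `s ↦ s ∘ levelExtend` is bijective. [cite: Milne2017, Ch. 12 Thm. 12.9 (a)] -/
theorem serreLevelPointsToSerrePoints_bijective : Function.Bijective (serreLevelPointsToSerrePoints R K) :=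
  ⟨fun s s' h => by
    simpa only [serrePointsToSerreLevelPoints_serreLevelPointsToSerrePoints] using congrArg (serrePointsToSerreLevelPoints R K) h,
   fun f => ⟨serrePointsToSerreLevelPoints R K f, serreLevelPointsToSerrePoints_serrePointsToSerreLevelPoints f⟩⟩

/-- **`S^K(R)` IN THE TWO CARRIERS: `serreLevelPoints R K ≃* serrePoints ℚ ℚ^{cm} K ι R`** for every commutative `ℚ`-algebra `R` — the isomorphism of
point groups induced by the isomorphism of character modules `levelCharEquiv` (`X ↦ D(X)` is an anti-equivalence). [cite: Milne2017, Ch. 12 Thm. 12.9 (a), Thm. 12.23]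
[cite: MilneShih1982Taniyama, III §1 (p. 231, «S^L is the largest quotient of S that splits over L»)] -/
def serreLevelPointsEquiv : serreLevelPoints R K ≃* serrePoints ℚ cmNumbers K cmNumbersConj R :=
  MulEquiv.ofBijective (serreLevelPointsToSerrePoints R K) (serreLevelPointsToSerrePoints_bijective R K)

variable {R K} in
/-- `serreLevelPointsEquiv` is `s ↦ s ∘ levelExtend`. [cite: Milne2017, Ch. 12 Thm. 12.9 (a)] -/
@[simp] theorem serreLevelPointsEquiv_apply (s : serreLevelPoints R K) : serreLevelPointsEquiv R K s = serreLevelPointsToSerrePoints R K s := rfl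

variable {R K} in
/-- Its inverse is `f ↦ f ∘ levelRestrict`. [cite: Milne2017, Ch. 12 Thm. 12.9 (a)] -/
@[simp] theorem serreLevelPointsEquiv_symm_apply (f : serrePoints ℚ cmNumbers K cmNumbersConj R) :
    (serreLevelPointsEquiv R K).symm f = serrePointsToSerreLevelPoints R K f :=
  (MulEquiv.symm_apply_eq _).mpr (serreLevelPointsToSerrePoints_serrePointsToSerreLevelPoints f).symm

variable {R K} in
/-- Values: `(serreLevelPointsEquiv s)(f) = s(f^{ℚ^{cm}})`. [cite: Milne2017, Ch. 12 Thm. 12.9 (a)] -/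
theorem serreLevelPointsEquiv_apply_ofAdd (s : serreLevelPoints R K)
    (g : infinityTypes (cmNumbers ≃ₐ[ℚ] cmNumbers) (K →ₐ[ℚ] cmNumbers) cmNumbersConj) :
    (serreLevelPointsEquiv R K s).1 (Multiplicative.ofAdd g) =
      (s : Multiplicative (lambdaLevel K) →* (cmNumbers ⊗[ℚ] R)ˣ) (Multiplicative.ofAdd (levelExtend K g)) := rfl

variable {R K} in
/-- Values of the inverse: `(serreLevelPointsEquiv⁻¹ f)(F) = f(F|_K)`. [cite: Milne2017, Ch. 12 Thm. 12.9 (a)] -/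
theorem serreLevelPointsEquiv_symm_apply_ofAdd (f : serrePoints ℚ cmNumbers K cmNumbersConj R) (F : lambdaLevel K) :
    ((serreLevelPointsEquiv R K).symm f : Multiplicative (lambdaLevel K) →* (cmNumbers ⊗[ℚ] R)ˣ) (Multiplicative.ofAdd F) =
      f.1
        (Multiplicative.ofAdd (levelRestrict K F)) :=
  (congrArg (fun s : serreLevelPoints R K => (s : Multiplicative (lambdaLevel K) →* (cmNumbers ⊗[ℚ] R)ˣ) (Multiplicative.ofAdd F))
    (serreLevelPointsEquiv_symm_apply f)).trans (serrePointsToSerreLevelPoints_apply_ofAdd f F)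

variable {R} {R' : Type u} [CommRing R'] [Algebra ℚ R'] in
/-- `serreLevelPointsEquiv` is natural in `R` (a morphism of point functors on `ℚ`-algebras). [cite: Milne2017, Ch. 12 Thm. 12.9 (a)] -/
theorem map_serreLevelPointsEquiv (φ : R →ₐ[ℚ] R') (s : serreLevelPoints R K) :
    torusPoints.map ℚ cmNumbers R (infinityTypesRep (cmNumbers ≃ₐ[ℚ] cmNumbers) (K →ₐ[ℚ] cmNumbers) cmNumbersConj) R' φ
        (serreLevelPointsEquiv R K s) =
      serreLevelPointsEquiv R' K (torusPoints.map ℚ cmNumbers R (lambdaLevelRep K) R' φ s) := rfl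

variable {R K} in
/-- **THE PROJECTION `S(R) → S^K(R)` IN skel-3's CARRIER evaluates at FILE 1's `extendLevel`**: `(serreLevelPointsEquiv (toLevel s))(f) = s(extendLevel K f)`.
[cite: MilneCM2006, Ch. I §4 p. 42 («(S, μ_can) = lim← (S^K, μ^K)»)] -/
theorem serreLevelPointsEquiv_toLevel_apply_ofAdd (s : serreLimitPoints R)
    (g : infinityTypes (cmNumbers ≃ₐ[ℚ] cmNumbers) (K →ₐ[ℚ] cmNumbers) cmNumbersConj) :
    (serreLevelPointsEquiv R K (toLevel R K s)).1 (Multiplicative.ofAdd g) =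
      (s : Multiplicative infinityTypesCM →* (cmNumbers ⊗[ℚ] R)ˣ) (Multiplicative.ofAdd (extendLevel K g)) := rfl

variable {R K} in
/-- Prop. 4.20 on points, pointwise: `(transition s)(f^{ℚ^{cm}}) = s((X^*(Nm) f)^{ℚ^{cm}})`. [cite: MilneCM2006, Ch. I §4 Prop. 4.20] -/
theorem serreLevelPointsEquiv_transition_apply {K' : IntermediateField ℚ cmNumbers} [FiniteDimensional ℚ K'] (h : K ≤ K') (s : serreLevelPoints R K')
    (g : infinityTypes (cmNumbers ≃ₐ[ℚ] cmNumbers) (K →ₐ[ℚ] cmNumbers) cmNumbersConj) :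
    (serreLevelPointsEquiv R K (transition R h s)).1 (Multiplicative.ofAdd g) =
      (normSerre ℚ cmNumbers cmNumbersConj (levelInclusion h) R (serreLevelPointsEquiv R K' s)).1 (Multiplicative.ofAdd g) :=
  calc (serreLevelPointsEquiv R K (transition R h s)).1 (Multiplicative.ofAdd g)
      = (transition R h s).1 (Multiplicative.ofAdd (levelExtend K g)) := serreLevelPointsEquiv_apply_ofAdd _ g
    _ = s.1 (Multiplicative.ofAdd (Submodule.inclusion (lambdaLevel_mono h) (levelExtend K g))) :=
        transition_apply_ofAdd R h s _ (levelExtend K g).2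
    _ = s.1 (Multiplicative.ofAdd (levelExtend K' (inflateI cmNumbersConj (restrictEmb (Ω := cmNumbers) (levelInclusion h)) g))) :=
        congrArg (fun y : lambdaLevel K' => s.1 (Multiplicative.ofAdd y)) (inclusion_mono_levelExtend h g)
    _ = (serreLevelPointsEquiv R K' s).1 (Multiplicative.ofAdd (inflateI cmNumbersConj (restrictEmb (Ω := cmNumbers) (levelInclusion h)) g)) :=
        (serreLevelPointsEquiv_apply_ofAdd s _).symm
    _ = (normSerre ℚ cmNumbers cmNumbersConj (levelInclusion h) R (serreLevelPointsEquiv R K' s)).1 (Multiplicative.ofAdd g) :=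
        (normSerre_apply_ofAdd ℚ cmNumbers cmNumbersConj (levelInclusion h) R _ g).symm

variable {R K} in
/-- **THE TRANSITION MAPS ARE THE NORM MAPS (Prop. 4.20 on points)**: for `K ⊆ K′`, g13-#4's `transition : S^{K′}(R) → S^K(R)` is g11's `normSerre` along
`levelInclusion (K ⊆ K′)` under the identifications `serreLevelPointsEquiv`. [cite: MilneCM2006, Ch. I §4 Prop. 4.20] [cite: MilneShih1982Taniyama, III §1 (p. 231, «the norm map induces a homomorphism S^{L'} → S^L»)] -/
theorem serreLevelPointsEquiv_transition {K' : IntermediateField ℚ cmNumbers} [FiniteDimensional ℚ K'] (h : K ≤ K') (s : serreLevelPoints R K') :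
    serreLevelPointsEquiv R K (transition R h s) =
      normSerre ℚ cmNumbers cmNumbersConj (levelInclusion h) R (serreLevelPointsEquiv R K' s) := by
  refine Subtype.ext (MonoidHom.ext fun x => ?_)
  exact serreLevelPointsEquiv_transition_apply h s (Multiplicative.toAdd x)

end Points

end CMNumbers

end Literature.NumberTheory.ComplexMultiplication
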